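/-
Copyright: cell `langlands-arthur-audit` (papers/Langlands/langlands-arthur-audit), unit `pub-arthur-typer-g5`
(LEAN TYPER gen 5, 2026-08-18).  Staged for the tree under `Literature/NumberTheory/Automorphic/Arthur2013/Leaves/`
(LEAN-IN-TREE rule 2026-08-18); imports `Intertwining` (§11) and the [KMSW] dependency DAG.
-/
import Literature.NumberTheory.Automorphic.Arthur2013.Leaves.Intertwining
import Literature.NumberTheory.Automorphic.KMSW2014.DependencyDag

/-!
# Arthur (2013) audit, typed leaves — §14 the local intertwining relation for INNER FORMS of unitary groups with content ([KMSW] Theorem* 2.6.2 = `thm:lir`; DAG nodes `KMSW2014.Nodes.LIR` / `LIRg`)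

§11 (`Intertwining`) types Arthur's (A-LIR) `f′_G(ψ, s_ψ s_u) = f_G(ψ, u)` ([Mok] Thm 3.4.3, [AGIKMS] §1.10) on
regions of QUASI-SPLIT scopes (`Book.localStated`, `Mok.localStated`), and records (`lir_regions_decide`) that
neither region contains an inner form.  The one source audited by the cell that STATES a local intertwining
relation for inner forms is [KMSW] = `KalethaEtAl2014` (arXiv:1409.3731v3; TeX held as
`src/1409.3731/chap2.tex`): Theorem* 2.6.2 (`\label{thm:lir}`), for the extended pure inner twists
`Ξ : G* → G` of `G* = U_{E/F}(N)`; the cell's module `KMSW2014.DependencyDag` (M11) carries it as the opaque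
rank-indexed nodes `LIR` (as stated) and `LIRg` (as proved in that paper: bounded = generic parameters, `E/F` a
quadratic extension of FIELDS — `chap4.tex:L1313`, `L1096`), with no content-carrying reading so far.  This
module supplies one, over §11's `LeviData` / `EndoData` plus a small uninterpreted signature `InnerData` for
what is NEW for inner forms and therefore a visible hypothesis mismatch with the quasi-split statements:
RELEVANCE of `ψ` for `Ξ` (packets may be empty, `f_{G,Ξ}(ψ,u♮) := 0` for irrelevant `ψ`), the KOTTWITZ SIGN
`e(G)` in the identity `f′_{G,Ξ}(ψ, s_ψ u⁻¹) = e(G) f_{G,Ξ}(ψ, u♮)`, the triviality of `R_P(u♮, Ξ, π, ψ, ψ_F)`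
on `W_ψ(M*,G*)^rad` (part 1) and the dependence of `f_{G,Ξ}(ψ,u♮)` on the image of `u` in `S♮_ψ` only (part 2).
Typed: the three parts `KMSW.LIR1/2/3`, the statement at `(G, M, ψ_M)` (`KMSW.Thm262At`), the region-indexed
family `InnerIntertwining`, the content-carrying names `KMSW.Tlir` (as stated) / `KMSW.Tlirg` (as proved), the
reading bridge `KMSW.ReadsLIR` with `KMSW.Tlirg_of_leaves` / `KMSW.Tlir_of_leaves` (from M11's
`scope_of_leaves` / `full_of_leaves`: the latter needs the unwritten sequels), a consistency witness, and the
kernel facts `KMSW.LIR3_iff_ALIR` (at a scope with `(G:G°) = 1`, `e(G) = 1` and `ψ` relevant, part 3 IS §11's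
(A-LIR) — so on quasi-split unitary scopes the [KMSW] and [Mok] typings agree literally) and
`innerLIR_regions_decide` (an extended pure inner twist of `U(3)` over a `p`-adic field with generic
parameters lies in [KMSW]'s proved LIR region and in neither quasi-split region; with non-generic parameters
it lies in the stated region only; an inner form of `Sp₄` lies in none).  [KMSW]'s own caveat
(`chap0.tex:L27`, VERBATIM): "Our formulation of local intertwining operators and local intertwining relations
is a little different. It is technical to explain here but the reader is referred to Chapter \ref{chapter2}
below for details." — the operators are NOT objects here either (only traces and the triviality relation), so
that difference is invisible at this level (cell `DIVERGENCE.md` D-TY-46 … D-TY-49).  [KMSW] is an arXiv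
preprint whose sequels [KMS_A], [KMS_B] have not appeared (cell `inputs/INDEX.md`, 2026-08-18); its statements
are quoted VERBATIM with file and line.  No `axiom`, `sorry`, `opaque`; no Mathlib.
-/

set_option autoImplicit false

namespace Literature.NumberTheory.Automorphic.Arthur2013.Leaves

variable {Ω : World} {D : ShapeData Ω}

/-! ## §14.1  The inner-twist data of [KMSW] §2.6 over a `LeviData` -/

section InnerTwistData

/-- **[KMSW] §2.6 data attached to an equivalence class `Ξ : G* → G` of extended pure inner twists**, over
§11's `LeviData` (whose `Levi`, `ParamM`, `NEl`, `packetM`, `trOp` are read at an inner scope as `(M*, P*)`,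
`ψ ∈ Ψ(M*)`, `u ∈ N_ψ(M*,G*)`, `Π_ψ(M, Ξ_M)` and `tr(R_P(u♮, Ξ, π, ψ, ψ_F) 𝓘_P(π)(f))`).  `src/1409.3731/
chap2.tex:L396`, VERBATIM: "Let $F$ be a local field, $E/F$ a quadratic algebra, and $G^*=U_{E/F}(N)$. Let $\Xi
: G^* \rw G$ be an equivalence class of extended pure inner twists and $(M^*,P^*)$ be a proper standard
parabolic pair of $G^*$."; `L398`: "Given $\psi \in \Psi(M^*)$ and $u \in N_\psi(M^*,G^*)$ we introduce a linear
form $f \mapsto f_{G,\Xi}(\psi, u^\natural)$ where $ u^\natural$ is the image of $u$ in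
$N^\natural_\psi(M^*,G^*)$. If $\psi$ is not relevant for $\Xi : G^* \rw G$ then $f_{G,\Xi}(\psi, u^\natural)$ is
defined to be zero (since we think of the underlying induced representation and the intertwining operator to be
zero). If $\psi$ is relevant for $\Xi$, then the Levi subgroup $M^*$ of $G^*$ transfers to $G$ and we let
$(M,P)$ be a parabolic pair for $G$ corresponding to $(M^*,P^*)$ and write $\Xi_M : M^* \rw M$ for the associated
equivalence class of extended pure inner twists."  UNINTERPRETED: relevance, `W_ψ(M*,G*)^rad`, `S♮_ψ`, the
operators and the Kottwitz sign are fields; nothing relates them (cell DIVERGENCE D-TY-46).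
[cite: KalethaEtAl2014, §2.6 setting (arXiv v3 chap2.tex l.396-402; a signature, not a theorem)] -/
structure InnerData (I : LeviData Ω D) where
  /-- "`ψ` is relevant for `Ξ : G* → G`" -/
  relevant : (s : LocalClassicalScope) → (L : I.Levi s) → I.ParamM s L → Bool
  /-- "`u♮` belongs to `W_ψ(M*,G*)^rad`" -/
  inWrad : (s : LocalClassicalScope) → (L : I.Levi s) → (ψM : I.ParamM s L) → I.NEl s L ψM → Prop
  /-- the group `S♮_ψ` (target of "the image of `u`") -/
  SNat : (s : LocalClassicalScope) → (L : I.Levi s) → I.ParamM s L → Type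
  /-- `u ↦` the image of `u` in `S♮_ψ` -/
  imageS : (s : LocalClassicalScope) → (L : I.Levi s) → (ψM : I.ParamM s L) → I.NEl s L ψM → SNat s L ψM
  /-- "`R_P(u♮, Ξ, π, ψ, ψ_F) = 1`" for `π ∈ Π_ψ(M, Ξ_M)` -/
  opTrivial : (s : LocalClassicalScope) → (L : I.Levi s) → (ψM : I.ParamM s L) → I.NEl s L ψM →
    I.IrrM s L → Prop
  /-- the Kottwitz sign `e(G)` of the group of scope `s` (`chap1mainthms.tex:L138` "The Kottwitz sign $e(G)$") -/
  sign : LocalClassicalScope → Val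

variable {I : LeviData Ω D}

/-- **`f_{G,Ξ}(ψ, u♮)`** (`chap2.tex:L399–L400`, VERBATIM): "Let $\Pi_\psi(M,\Xi_M)$ be the packet of
representations of $M(F)$ corresponding to $\psi$ via Theorem \ref{thm:locclass-single}. If $\Pi_\psi(M,\Xi_M)$
happens to be empty (which may only happen when $\psi$ is non-generic), we define $f_{G,\Xi}(\psi, u^\natural)$
to be zero again. Now assume $\Pi_\psi(M,\Xi_M)\neq \emptyset$. Using the self-intertwining operators
$R_P(u^\natural,\Xi,\pi,\psi,\psi_F)$ constructed in Section \ref{sec:iop} for all members $\pi \in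
\Pi_\psi(M,\Xi_M)$, we define a linear form $f \mapsto f_{G,\Xi}(\psi, u^\natural)$ on $\mc{H}(G)$ as follows \[
f_{G,\Xi}(\psi,u^\natural) = \sum_{\pi \in \Pi_\psi(M,\Xi_M)} \tx{tr}(R_P(u^\natural,\Xi,\pi,\psi,\psi_F)\mc{I}
_P(\pi)(f)). \]"  TYPED: §11's raw packet sum `LeviData.spectralSide` (empty packet ⇒ `0` automatically) if
`ψ` is relevant, else `0`. [cite: KalethaEtAl2014, §2.6 definition of f_{G,Ξ}(ψ,u♮) (chap2.tex l.398-400)] -/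
def InnerData.fG (J : InnerData I) (s : LocalClassicalScope) (L : I.Levi s) (ψM : I.ParamM s L)
    (u : I.NEl s L ψM) (f : Ω.Test s) : Val :=
  cond (J.relevant s L ψM) (I.spectralSide s L ψM u f) 0

/-- `f_{G,Ξ}(ψ,u♮)` for relevant `ψ` is the packet sum. [folklore] (unfolding, proved here) -/
theorem InnerData.fG_of_relevant (J : InnerData I) {s : LocalClassicalScope} {L : I.Levi s} {ψM : I.ParamM s L}
    (h : J.relevant s L ψM = true) (u : I.NEl s L ψM) (f : Ω.Test s) :
    J.fG s L ψM u f = I.spectralSide s L ψM u f := by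
  unfold InnerData.fG; rw [h]; rfl

/-- `f_{G,Ξ}(ψ,u♮) = 0` for irrelevant `ψ`. [folklore] (unfolding, proved here) -/
theorem InnerData.fG_of_irrelevant (J : InnerData I) {s : LocalClassicalScope} {L : I.Levi s}
    {ψM : I.ParamM s L} (h : J.relevant s L ψM = false) (u : I.NEl s L ψM) (f : Ω.Test s) :
    J.fG s L ψM u f = 0 := by
  unfold InnerData.fG; rw [h]; rfl

/-- the convention `e(G) = 1` at quasi-split scopes (the Kottwitz sign of a quasi-split group is `1`); NOT
imposed on `InnerData`, available as a hypothesis. [folklore] (Kottwitz's sign convention, as an optional constraint on the signature) -/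
def InnerData.SignQS (J : InnerData I) : Prop :=
  ∀ s : LocalClassicalScope, s.form = .quasiSplit → J.sign s = 1

end InnerTwistData

/-! ## §14.2  Theorem* 2.6.2 with content -/

section TheoremLIR

variable {I : LeviData Ω D}

/-- **[KMSW] Thm* 2.6.2, part 1** (`chap2.tex:L433–L436`, VERBATIM): "\begin{thm*}[Local intertwining relation]
\label{thm:lir} Let $\psi \in \Psi(M^*)$, $u \in N_\psi(M^*,G^*)$, and $f \in \mc{H}(G)$. Then \begin{enumerate}
\item Suppose that $\Pi_\psi(M,\Xi_M)$ is nonempty (so $\psi$ is relevant in particular). If $u^\natural$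
belongs to $W_\psi(M^*,G^*)^\tx{rad}$, then $R_P(u^\natural,\Xi,\pi,\psi,\psi_F)=1$ for all representations
$\pi \in \Pi_\psi(M,\Xi_M)$."  TYPED at `(G, M, ψ_M)`: packet non-empty → for every `u` with `u♮ ∈ W^rad` and
every member `π`, `opTrivial u π`. [cite: KalethaEtAl2014, Thm* 2.6.2 (1) (arXiv v3 chap2.tex l.433-436)] -/
def KMSW.LIR1 (I : LeviData Ω D) (J : InnerData I) (s : LocalClassicalScope) (L : I.Levi s)
    (ψM : I.ParamM s L) : Prop :=
  I.packetM s L ψM ≠ [] → ∀ u : I.NEl s L ψM, J.inWrad s L ψM u →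
    ∀ π, π ∈ I.packetM s L ψM → J.opTrivial s L ψM u π

/-- **[KMSW] Thm* 2.6.2, part 2** (`chap2.tex:L437`, VERBATIM): "\item The complex number $f_{G,\Xi}(\psi,
u^\natural)$ depends only on the image of $u$ in  $S_\psi^\natural$."  TYPED: equal images in `S♮_ψ` ⇒ equal
linear forms. [cite: KalethaEtAl2014, Thm* 2.6.2 (2) (arXiv v3 chap2.tex l.437)] -/
def KMSW.LIR2 (I : LeviData Ω D) (J : InnerData I) (s : LocalClassicalScope) (L : I.Levi s)
    (ψM : I.ParamM s L) : Prop :=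
  ∀ u u' : I.NEl s L ψM, J.imageS s L ψM u = J.imageS s L ψM u' →
    ∀ f : Ω.Test s, J.fG s L ψM u f = J.fG s L ψM u' f

/-- **[KMSW] Thm* 2.6.2, part 3 — the local intertwining relation for the inner twist `Ξ : G* → G`**
(`chap2.tex:L438–L441`, VERBATIM): "\item We have an equality \begin{equation} \label{eq:lir}
f_{G,\Xi}'(\psi,s_\psi u^{-1})=e(G)f_{G,\Xi}(\psi, u^\natural). \end{equation} \end{enumerate} \end{thm*}", with
the endoscopic side defined at `L403–L405` (VERBATIM): "We construct a second linear form $f \mapsto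
f_{G,\Xi}'(\psi,s_\psi u^{-1})$ on $\mc{H}(G)$ in the following way. Fix $f \in \mc{H}(G)$. For any semi-simple
element $s \in S_\psi$, let $\psi^{\fke}\in \Psi(G^\fke)$ and $\mf{e}\in \cE(G^*)$ be associated to $\psi$ and
$s$ as in \ref{sub:endo-correspondence}. (There is no need to take $\psi^{\fke}$ as an orbit under the strict
outer automorphism group since the latter group is trivial in our case.) From $\psi^{\fke}$ we obtain the stable
linear form on $\mc{H}(G^\mf{e})$ in part 4 of Theorem \ref{thm:locclass-single}. % The value of this stable
linear form on all functions $f^\mf{e} \in \mc{H}(G^\mf{e})$ whose orbital integrals match those of $f$ with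
respect to the transfer factor $\Delta[\mf{e},\Xi]$ is the same. We call this value $f_{G,\Xi}'(\psi,s)$." and
the two printed cases (`L445–L446`, VERBATIM): "\item If $\psi$ is relevant for $\Xi$ then
$f_{G,\Xi}'(\psi,s_\psi u^{-1})=e(G)f_{G,\Xi}(\psi, u^\natural)$. \item If $\psi$ is not relevant for $\Xi$
then $ f_G'(\psi,s_\psi u^{-1})=0$."  TYPED with §11's endoscopic side (`EndoData.stableSide`: the stable linear
forms of the two factors of `G^𝔢` at `ψ^𝔢`, on `Δ[𝔢,Ξ]`-matching functions `EMatches`) at `x = s_u + s_ψ ∈ A_ψ`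
(the image of `s_ψ u⁻¹`): for all matching `(f, f₁, f₂)`, `f′₁ f′₂ = e(G) · f_{G,Ξ}(ψ,u♮)`.  No index
`(G:G°)` (unitary groups are connected). [cite: KalethaEtAl2014, Thm* 2.6.2 (3) = (eq:lir) (arXiv v3 chap2.tex l.438-446, l.403-405)] -/
def KMSW.LIR3 (I : LeviData Ω D) (J : InnerData I) (E : EndoData Ω D) (s : LocalClassicalScope)
    (L : I.Levi s) (ψM : I.ParamM s L) (u : I.NEl s L ψM) : Prop :=
  let ψ := I.induced s L ψM
  let x := (I.sU s L ψM u).add (D.shape s ψ).sPsi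
  ∀ (f : Ω.Test s) (f₁ : Ω.Test (E.e₁ s ψ x)) (f₂ : Ω.Test (E.e₂ s ψ x)), E.EMatches s ψ x f f₁ f₂ →
    E.stableSide s ψ x f₁ f₂ = J.sign s * J.fG s L ψM u f

/-- **[KMSW] Thm* 2.6.2 at `(G, M, ψ_M)`**: parts 1, 2 and, for every `u`, 3.  (`chap2.tex:L443`, VERBATIM:
"Note that the multiplicativity of $R_P(u^\natural,\Xi,\pi,\psi,\psi_F)$ in $u^\natural$ formulated in Lemma
\ref{lem:iopm} implies that the second point follows from the first. However, we will only be able to deduce the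
first point once we have proved the second by different means." — that implication uses the operators and is
not reproduced.) [cite: KalethaEtAl2014, Thm* 2.6.2 (arXiv v3 chap2.tex l.433-441)] -/
def KMSW.Thm262At (I : LeviData Ω D) (J : InnerData I) (E : EndoData Ω D) (s : LocalClassicalScope)
    (L : I.Levi s) (ψM : I.ParamM s L) : Prop :=
  KMSW.LIR1 I J s L ψM ∧ KMSW.LIR2 I J s L ψM ∧ ∀ u, KMSW.LIR3 I J E s L ψM u

/-- **Thm* 2.6.2 on a region of `(scope, shape of ψ)`.** [folklore] (region-indexed family shape) -/
def InnerIntertwining (I : LeviData Ω D) (J : InnerData I) (E : EndoData Ω D)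
    (R : LocalClassicalScope → ParamShape Nat → Prop) : Prop :=
  ∀ s (L : I.Levi s) (ψM : I.ParamM s L), R s (D.shape s (I.induced s L ψM)) → KMSW.Thm262At I J E s L ψM

/-- Monotonicity in the region. [folklore] (bookkeeping) -/
theorem InnerIntertwining.mono (I : LeviData Ω D) (J : InnerData I) (E : EndoData Ω D)
    {R R' : LocalClassicalScope → ParamShape Nat → Prop} (h : ∀ s σ, R' s σ → R s σ) :
    InnerIntertwining I J E R → InnerIntertwining I J E R' :=
  fun H s L ψM hR => H s L ψM (h _ _ hR)

/-- **`KMSW.Tlir` — [KMSW] Thm* 2.6.2 AS STATED**: every `ψ ∈ Ψ(M*)`, every extended pure inner twist of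
`U_{E/F}(N)`, `F` local of characteristic zero, "$E/F$ a quadratic algebra" (`chap2.tex:L396`) — on the region
`KMSW.localStated` of §5 (type `U n`, characteristic zero, any form, any parameters).  The content M11's node
`KMSW2014.Nodes.LIR` names; beyond `KMSW.Tlirg` it is deferred by [KMSW] to the unwritten sequels
(`chap2.tex:L111`, VERBATIM: "To treat non-tempered representations, we need the analog of Lemmas
\ref{lem:iop1rm} and \ref{lem:iop1pm} for general parameters $\psi \in \Psi(M^*)$. We formulate this lemma
now, but postpone the proof to \cite{KMS_A}."; `chap4.tex:L1096`, VERBATIM: "The case of inner forms of linear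
groups, corresponding to $E=F\times F$, will be treated in \cite{KMS_B}.").
[cite: KalethaEtAl2014, Thm* 2.6.2 as stated (arXiv v3 chap2.tex l.433-441; region `KMSW.localStated`)] -/
def KMSW.Tlir (I : LeviData Ω D) (J : InnerData I) (E : EndoData Ω D) : Prop :=
  InnerIntertwining I J E fun s _ => KMSW.localStated s

/-- **`KMSW.Tlirg` — [KMSW] Thm* 2.6.2 AS PROVED in arXiv:1409.3731** (`chap4.tex:L1313`, VERBATIM): "We have
now completed the proof of Theorem \ref{thm:lir} for all parameters $\phi_{M^*} \in \Phi_{2,\tx{bdd}}(M^*)$. We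
will now argue that Theorem \ref{thm:lir} holds in the more general case $\phi_{M^*} \in \Phi_\tx{bdd}(M^*)$."
and (`L1096`) "let $E/F$ be a quadratic extension of local fields." — region: `KMSW.localStated` AND the
induced shape tempered (all `d_i = 1`, §5 `IsTempered`; bounded = generic); the scope tag `U n` is read as
`U_{E/F}(N)` for a quadratic FIELD extension `E/F` (§3's reading of the tag; the split algebra `E = F × F`,
i.e. inner forms of `GL_N`, is not a `U` scope).  The content M11's node `KMSW2014.Nodes.LIRg` names.
[cite: KalethaEtAl2014, Thm* 2.6.2 for bounded parameters (arXiv v3 chap4.tex l.1313, l.1096; region typed here)] -/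
def KMSW.Tlirg (I : LeviData Ω D) (J : InnerData I) (E : EndoData Ω D) : Prop :=
  InnerIntertwining I J E fun s σ => KMSW.localStated s ∧ σ.IsTempered

/-- stated ⇒ proved slice. [folklore] (bookkeeping) -/
theorem KMSW.Tlirg_of_Tlir (I : LeviData Ω D) (J : InnerData I) (E : EndoData Ω D) :
    KMSW.Tlir I J E → KMSW.Tlirg I J E :=
  InnerIntertwining.mono I J E fun _ _ h => h.1

/-- **Part 3 IS Arthur's (A-LIR) where the inner-form features are switched off.**  At a scope with
`(G:G°) = 1` and `e(G) = 1` and for `ψ` relevant, `KMSW.LIR3` and §11's `ALIR` are the same statement (both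
read the endoscopic side through the same `EndoData`).  Hence on quasi-split unitary scopes (connected,
`e = 1`, everything relevant) the [KMSW] typing and the [Mok] typing `Mok.T343` agree literally, and the
visible differences for inner forms are exactly relevance and the sign. [folklore] (kernel comparison, proved here) -/
theorem KMSW.LIR3_iff_ALIR (I : LeviData Ω D) (J : InnerData I) (E : EndoData Ω D) (s : LocalClassicalScope)
    (L : I.Levi s) (ψM : I.ParamM s L) (u : I.NEl s L ψM) (h1 : (D.indexGG0 s : Val) = 1)
    (h2 : J.sign s = 1) (h3 : J.relevant s L ψM = true) :
    KMSW.LIR3 I J E s L ψM u ↔ ALIR I E s L ψM u := by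
  constructor
  · intro h f f₁ f₂ hm
    have hx := h f f₁ f₂ hm
    rw [h2, Int.one_mul, J.fG_of_relevant h3] at hx
    rw [h1, Int.one_mul]
    exact hx
  · intro h f f₁ f₂ hm
    have hx := h f f₁ f₂ hm
    rw [h1, Int.one_mul] at hx
    rw [h2, Int.one_mul, J.fG_of_relevant h3]
    exact hx

/-- **For irrelevant `ψ`, part 3 says the endoscopic side VANISHES** on matching functions (the second printed
case, `chap2.tex:L446`). [cite: KalethaEtAl2014, Thm* 2.6.2 (3), irrelevant case (chap2.tex l.446; unfolding proved here)] -/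
theorem KMSW.LIR3_irrelevant (I : LeviData Ω D) (J : InnerData I) (E : EndoData Ω D) (s : LocalClassicalScope)
    (L : I.Levi s) (ψM : I.ParamM s L) (u : I.NEl s L ψM) (h3 : J.relevant s L ψM = false) :
    KMSW.LIR3 I J E s L ψM u ↔
      (let ψ := I.induced s L ψM
       let x := (I.sU s L ψM u).add (D.shape s ψ).sPsi
       ∀ (f : Ω.Test s) (f₁ : Ω.Test (E.e₁ s ψ x)) (f₂ : Ω.Test (E.e₂ s ψ x)), E.EMatches s ψ x f f₁ f₂ →
         E.stableSide s ψ x f₁ f₂ = 0) := by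
  constructor
  · intro h ψ x f f₁ f₂ hm
    have hx := h f f₁ f₂ hm
    rw [J.fG_of_irrelevant h3, Int.mul_zero] at hx
    exact hx
  · intro h f f₁ f₂ hm
    rw [J.fG_of_irrelevant h3, Int.mul_zero]
    exact h f f₁ f₂ hm

end TheoremLIR

/-! ## §14.3  Reading the [KMSW] DAG nodes `LIR` / `LIRg`; regions decided -/

section Bridge

variable {I : LeviData Ω D}

/-- **Readings of the [KMSW] nodes `LIR` (Thm* 2.6.2 as stated) and `LIRg` (as proved).**  Hypotheses, in the
pattern of M22 `KMSW.ReadsFull`: the rank-indexed nodes at every rank ↔ the typed statements `KMSW.Tlir` /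
`KMSW.Tlirg` (the rank slicing of M11 is not reproduced inside the typed statements, cell DIVERGENCE D-TY-45).
[cite: KalethaEtAl2014, Thm* 2.6.2 (chap2.tex l.433-441; reading hypothesis)] -/
structure KMSW.ReadsLIR (κ : KMSW2014.Nodes) (Ω : World) (D : ShapeData Ω) (I : LeviData Ω D)
    (J : InnerData I) (E : EndoData Ω D) : Prop where
  /-- `LIR` at every rank ↔ Thm* 2.6.2 as stated -/
  lir : (∀ N, κ.LIR N) ↔ KMSW.Tlir I J E
  /-- `LIRg` at every rank ↔ Thm* 2.6.2 for bounded parameters, `E/F` a field -/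
  lirg : (∀ N, κ.LIRg N) ↔ KMSW.Tlirg I J E

/-- **[KMSW, Thm* 2.6.2] for bounded parameters from the leaves** of the KMSW DAG in its PROVED scope (M11
`KMSW2014.Nodes.scope_of_leaves`: chapter edges, supply edges, the [Mok] import, published leaves, the general
weighted fundamental lemma), under the reading.  No new leaf. [cite: KalethaEtAl2014, Thm* 2.6.2 for bounded parameters (chap4.tex l.1313; bookkeeping proved here)] -/
theorem KMSW.Tlirg_of_leaves {κ : KMSW2014.Nodes} {J : InnerData I} {E : EndoData Ω D}
    (h : KMSW.ReadsLIR κ Ω D I J E) (B : κ.ChapterEdges) (S : κ.SupplyEdges) (Im : κ.ImportedLeaves)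
    (P : κ.PublishedLeaves) (U : κ.UnwrittenLeaves) : KMSW.Tlirg I J E :=
  h.lirg.mp fun N => (κ.scope_of_leaves B S Im P U N).2.1

/-- **[KMSW, Thm* 2.6.2] AS STATED from the leaves** — needs in addition the two unwritten sequels [KMS_A],
[KMS_B] (M11 `KMSW2014.Nodes.full_of_leaves`), under the reading.
[cite: KalethaEtAl2014, Thm* 2.6.2 as stated (chap2.tex l.433-441; bookkeeping proved here)] -/
theorem KMSW.Tlir_of_leaves {κ : KMSW2014.Nodes} {J : InnerData I} {E : EndoData Ω D}
    (h : KMSW.ReadsLIR κ Ω D I J E) (B : κ.ChapterEdges) (S : κ.SupplyEdges) (Im : κ.ImportedLeaves)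
    (P : κ.PublishedLeaves) (U : κ.UnwrittenLeaves) (Q : κ.UnwrittenSequels) : KMSW.Tlir I J E :=
  h.lir.mp fun N => (κ.full_of_leaves B S Im P U Q N).2.1

/-- A node assignment reading `LIR` / `LIRg` with content. [folklore] (consistency witness) -/
def KMSW.lirNodes (Ω : World) (D : ShapeData Ω) (I : LeviData Ω D) (J : InnerData I) (E : EndoData Ω D)
    (rest : KMSW2014.Nodes) : KMSW2014.Nodes :=
  { rest with LIR := fun _ => KMSW.Tlir I J E, LIRg := fun _ => KMSW.Tlirg I J E }

/-- The readings are CONSISTENT. [folklore] (consistency) -/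
theorem KMSW.lirNodes_reads (Ω : World) (D : ShapeData Ω) (I : LeviData Ω D) (J : InnerData I)
    (E : EndoData Ω D) (rest : KMSW2014.Nodes) :
    KMSW.ReadsLIR (KMSW.lirNodes Ω D I J E rest) Ω D I J E where
  lir := ⟨fun H => H 0, fun H _ => H⟩
  lirg := ⟨fun H => H 0, fun H _ => H⟩

/-- an extended pure inner twist of `U(3)` over a `p`-adic field, GENERIC parameters. [folklore] (explicit witness) -/
def innerUnitaryGenericScope : LocalClassicalScope :=
  { field := .nonarch 7 true, type := .U 3, form := .extendedPure, params := .temperedGeneric }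

/-- **The inner-form hypothesis mismatch for the LIR, decided on the scope tags.**  `innerUnitaryGenericScope`
is in [KMSW]'s local region (stated, and — parameters being generic — proved) and in NEITHER quasi-split region
(`Book.localStated`, `Mok.localStated`) on which §11 types (A-LIR); M12's `innerUnitaryScope` (non-generic
parameters) is in [KMSW]'s STATED region but in its deferred one (the typed `KMSW.Tlirg` additionally demands a
tempered shape); an inner form of `Sp₄` is in no LIR region of any source audited here.
[cite: KalethaEtAl2014, Thm* 2.6.2 scope (chap2.tex l.396; chap4.tex l.1096, l.1313; region comparison decided here)] -/
theorem innerLIR_regions_decide :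
    KMSW.localStated innerUnitaryGenericScope ∧ KMSW.localProved innerUnitaryGenericScope ∧
      ¬ Book.localStated innerUnitaryGenericScope ∧ ¬ Mok.localStated innerUnitaryGenericScope ∧
      KMSW.localStated innerUnitaryScope ∧ KMSW.localDeferred innerUnitaryScope ∧
      ¬ KMSW.localStated innerSymplecticScope ∧ ¬ Book.localStated innerSymplecticScope := by
  refine ⟨⟨⟨3, rfl⟩, rfl⟩, ⟨⟨3, rfl⟩, rfl, rfl⟩, by decide, by decide, ⟨⟨3, rfl⟩, rfl⟩,
    ⟨⟨3, rfl⟩, rfl, by decide⟩, ?_, by decide⟩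
  intro ⟨⟨_, h⟩, _⟩
  exact ClassicalType.noConfusion h

end Bridge

end Literature.NumberTheory.Automorphic.Arthur2013.Leaves
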